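import Summits.QuantumFields.YangMills.Theorems.BalabanUVNodesN08HaarCompatibilityGuardJacobianContractionDet
import Literature.MathematicalPhysics.QuantumFieldTheory.Balaban1983to89.BlockAveragingHaarAC

/-!
# BalabanUVNodes ∕ N08 — THE DICTIONARY «guarded core map of the printed `SU(N)` average = pub-balaban's `Kmat` over the non-central indices»
# and the two-sided Jacobian pinch AT THE CORE MAP of (H_K-core) (part 5 of this lineage)

WIDTH SEAT `pub-ymgap-dag-n08-w6` g4 (R399 (3a) second wave; CLAIM-4 ∕ INTENT-5 of record HOME INBOX l.35378), 2026-08-28.  Track A, DAG node N08 =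
[Balaban1985UV3] Thm 1 p. 257 (compact) + Thm 2 p. 272, the typed (0.4) averaging = [Balaban1987RG1] (0.4) p. 253; key item K1⁷ `StabilityBAtRecordR13SepCoPH`
(stmt-QuantumFields-20542), `--supports … --as helper`.  COUNT-NEUTRAL.

THE POINT.  Sibling n08-w3's p620199 (`…GuardFibreCore`) made the fibre-law hypothesis (H_K) LATTICE-FREE: at a coarse bond `c` and frozen open holonomies
`V : Idx → G`, the guarded fibre law is the law of the CORE MAP `w ↦ [ℰ-average of (1 | Vᵢ w⁻¹)ᵢ]·w`, and its header reads «for the printed ℰ the core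
map on the guard is pub-balaban's `Kmat` … (E3a) is in the tree up to this dictionary».  THIS FILE TYPES THE DICTIONARY for the printed `SU(N)` average
`expMeanLogSU` (pub-balaban `BlockAveragingExpMeanLog`: `LoopAverage.avg` = `ESU` after the fixed enumeration, `ESU = eml` on the guard `δ_N = deltaSU`,
`eml = exp(|I|⁻¹ Σ log)`):
* §1 `coe_avg_expMeanLogSU`: on the guard, `↑(expMeanLogSU.avg W) = exp(|ι|⁻¹ • Σᵢ log ↑(W i))` for a family over ANY nonempty finite index type (the
  enumeration drops out of the sum).
* §2 ★★ `core_eq_kmat`: `↑([expMeanLogSU.avg (1 | Vᵢ w⁻¹)ᵢ]·w) = Kmat (fun i : {i // ¬IsCentral c i} => ↑(V i)) (fun _ => |Idx|⁻¹) ↑w` — the central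
  entries contribute `log 1 = 0`, the others `|Idx|⁻¹·log(Vᵢ w*)`; `guard_of_core` (each `Vᵢ w*` is in `Kmat`'s typed guard `deltaSU`), `weights_core`
  (weights `≥ 0`, total `#non-central ∕ |Idx| ≤ 1`).
* §3 ★★★ `core_tangent_pinch`: hence, by part 3c's `abs_det_leftTangentSU_pinch_specialUnitary`, every `ℝ`-linear endomorphism `T` of `𝔰𝔲(N)` agreeing
  with the left-trivialised tangent map of that `Kmat` at `w` satisfies `(1 − #non-central·|Idx|⁻¹)^{N² − 1} ≤ |det T| ≤ 1` — the Jacobian pinch at the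
  very letters of (H_K-core); parts 1∕2 (`exists_leftTangent_lieSU`) make `T` exist; the floor's base is `#central ∕ |Idx|` (= `L^{1−d}` at the [B10] slot
  by the sibling's count, not re-derived here).

HONEST FRAMING.  Count-neutral bookkeeping over pub-balaban's printed-average letters (`expMeanLogSU`, `ESU`, `eml`, `LoopAverage.avg`, `IsCentral`, `Kmat`) and
this lineage's parts 1–3c BY IMPORT; NO chart composition, NO window, NO density bound typed; (H_K) ∕ (H_K-core) NOT discharged; nothing of Bałaban's
asserted beyond the typed (0.4) operation's own definition; E6′ NOT decided; `hmass` NOT supplied; N08 NOT discharged; counts unmoved (typed 28∕28 ·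
discharged 5∕27); no summit statement is proved by this seat — one finite 𝕋⁴ programme at fixed ε, R4 closes the CONDITIONAL rung `BalabanLadder.UV` only;
the Yang–Mills mass gap (Clay) is NOT proved by any of this; nothing continuum ∕ ℝ⁴ ∕ OS.  0 `sorry`, 0 `def`, 0 `instance`, 0 `notation` (the group is spelled
`Matrix.specialUnitaryGroup (Fin N) ℂ` throughout), standard axioms.
-/

noncomputable section

open NormedSpace Finset
open scoped Matrix Matrix.Norms.L2Operator ComplexConjugate

namespace Summit.QuantumFields.YangMills.BalabanUVNodes.N08HaarCompatibilityGuardCoreKmatDictionary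

open Literature.MathematicalPhysics.QuantumFieldTheory.Balaban1983to89
open Literature.MathematicalPhysics.QuantumFieldTheory.Balaban1983to89.T4EMLTangentInjective
open Literature.MathematicalPhysics.QuantumFieldTheory.Balaban1983to89.ExpMeanLog
  (eml eml_eq_exp deltaSU expMeanLogSU ESU coe_ESU_of_small lt_third_of_lt_deltaSU)
open Literature.MathematicalPhysics.QuantumFieldTheory.Balaban1983to89.BlockAveraging (Idx)
open Literature.MathematicalPhysics.QuantumFieldTheory.Balaban1983to89.BlockAveragingHaarAC (IsCentral)
open Literature.MathematicalPhysics.QuantumFieldTheory.Balaban1983to89.T4AdjointCovarianceUnitary (lieSU)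
open Summit.QuantumFields.YangMills.BalabanUVNodes.N08HaarCompatibilityGuardJacobianContractionDet
open Literature.MathematicalPhysics.QuantumFieldTheory.Balaban1983to89.MatrixLog (mlog)

variable {N : ℕ} [NeZero N] {P : Params} {j : ℕ}


/-! ## §1 The printed average over an arbitrary finite index type, on the guard -/

/-- On the guard `∀ i, dist1 (W i) < δ_N`, the printed average of a family indexed by ANY nonempty finite type is
`exp(|I|⁻¹ Σᵢ log Wᵢ)` (pub-balaban's `LoopAverage.avg` = `E` after the fixed enumeration; `ESU` = `eml` on the guard; `eml_eq_exp`;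
the enumeration disappears from the sum). [cite: Balaban1987RG1, (0.4) p.253] -/
theorem coe_avg_expMeanLogSU {ι : Type*} [Fintype ι] [Nonempty ι] (W : ι → (Matrix.specialUnitaryGroup (Fin N) ℂ))
    (hW : ∀ i, dist1 (W i) < (expMeanLogSU : LoopAverage (Matrix.specialUnitaryGroup (Fin N) ℂ)).δ) :
    (((expMeanLogSU : LoopAverage (Matrix.specialUnitaryGroup (Fin N) ℂ)).avg W : (Matrix.specialUnitaryGroup (Fin N) ℂ)) : Matrix (Fin N) (Fin N) ℂ)
      = exp (((Fintype.card ι : ℂ))⁻¹ • ∑ i, mlog ((W i : (Matrix.specialUnitaryGroup (Fin N) ℂ)) : Matrix (Fin N) (Fin N) ℂ)) := by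
  set e := LoopAverage.enum ι with he
  have hW' : ∀ k, ‖(((W ∘ e.symm) k : (Matrix.specialUnitaryGroup (Fin N) ℂ)) : Matrix (Fin N) (Fin N) ℂ) - 1‖ < deltaSU (Fin N) := fun k => hW (e.symm k)
  show ((ESU (W ∘ e.symm) : (Matrix.specialUnitaryGroup (Fin N) ℂ)) : Matrix (Fin N) (Fin N) ℂ) = _
  rw [coe_ESU_of_small hW', eml_eq_exp, Fintype.card_fin]
  have hs : ∑ k, mlog ((((W ∘ e.symm) k : (Matrix.specialUnitaryGroup (Fin N) ℂ))) : Matrix (Fin N) (Fin N) ℂ)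
      = ∑ i, mlog ((W i : (Matrix.specialUnitaryGroup (Fin N) ℂ)) : Matrix (Fin N) (Fin N) ℂ) :=
    Equiv.sum_comp e.symm (fun i => mlog ((W i : (Matrix.specialUnitaryGroup (Fin N) ℂ)) : Matrix (Fin N) (Fin N) ℂ))
  rw [hs, Nat.sub_add_cancel Fintype.card_pos]

/-! ## §2 THE DICTIONARY: the guarded core map of the printed average IS `Kmat` over the non-central indices with equal weights `|Idx|⁻¹` -/

omit [NeZero N] in
/-- The matrix of the core family member: `1` at central indices, `V_i · w*` at the others. [folklore] -/
theorem coe_coreFamily (c : PBond P (j + 1)) (V : Idx P → (Matrix.specialUnitaryGroup (Fin N) ℂ)) (w : (Matrix.specialUnitaryGroup (Fin N) ℂ)) (i : Idx P) :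
    (((if IsCentral c i then (1 : (Matrix.specialUnitaryGroup (Fin N) ℂ)) else V i * w⁻¹ : (Matrix.specialUnitaryGroup (Fin N) ℂ))) : Matrix (Fin N) (Fin N) ℂ)
      = if IsCentral c i then 1 else (V i : Matrix (Fin N) (Fin N) ℂ) * star (w : Matrix (Fin N) (Fin N) ℂ) := by
  split_ifs with h
  · rfl
  · rw [Submonoid.coe_mul, ← Matrix.star_eq_inv]
    rfl

/-- ★★ **THE DICTIONARY.**  On the guard, the lattice-free core map of the typed (0.4) averaging for the PRINTED exp-mean-log `SU(N)` average
(sibling n08-w3's p620199 `…GuardFibreCore`, (H_K-core)) is pub-balaban's exp-mean-log fibre map over the NON-central indices with the equal weights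
`|Idx|⁻¹`:  `[expMeanLogSU-avg of (1 | Vᵢ w⁻¹)ᵢ]·w = Kmat (V|_{non-central}) (|Idx|⁻¹) w` (central entries contribute `log 1 = 0`).
[cite: Balaban1987RG1, (0.4) p.253 (the printed operation; the identity is bookkeeping)] -/
theorem core_eq_kmat (c : PBond P (j + 1)) (V : Idx P → (Matrix.specialUnitaryGroup (Fin N) ℂ)) (w : (Matrix.specialUnitaryGroup (Fin N) ℂ))
    (hg : ∀ i : Idx P, dist1 (if IsCentral c i then (1 : (Matrix.specialUnitaryGroup (Fin N) ℂ)) else V i * w⁻¹) < (expMeanLogSU : LoopAverage (Matrix.specialUnitaryGroup (Fin N) ℂ)).δ) :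
    ((((expMeanLogSU : LoopAverage (Matrix.specialUnitaryGroup (Fin N) ℂ)).avg (fun i : Idx P => if IsCentral c i then (1 : (Matrix.specialUnitaryGroup (Fin N) ℂ)) else V i * w⁻¹) * w : (Matrix.specialUnitaryGroup (Fin N) ℂ)))
        : Matrix (Fin N) (Fin N) ℂ)
      = Kmat (fun i : {i : Idx P // ¬ IsCentral c i} => ((V i : (Matrix.specialUnitaryGroup (Fin N) ℂ)) : Matrix (Fin N) (Fin N) ℂ))
          (fun _ => ((Fintype.card (Idx P) : ℝ))⁻¹) (w : Matrix (Fin N) (Fin N) ℂ) := by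
  rw [Submonoid.coe_mul, coe_avg_expMeanLogSU _ hg]
  show _ = exp _ * _
  congr 2
  -- the sum of logs: central entries vanish, the rest is the sum over the non-central subtype
  have hsplit := Fintype.sum_subtype_add_sum_subtype (IsCentral c)
    (fun i : Idx P => mlog ((((if IsCentral c i then (1 : (Matrix.specialUnitaryGroup (Fin N) ℂ)) else V i * w⁻¹ : (Matrix.specialUnitaryGroup (Fin N) ℂ))) : Matrix (Fin N) (Fin N) ℂ)))
  have hcentral : ∑ i : {i : Idx P // IsCentral c i},
      mlog ((((if IsCentral c (i : Idx P) then (1 : (Matrix.specialUnitaryGroup (Fin N) ℂ)) else V i * w⁻¹ : (Matrix.specialUnitaryGroup (Fin N) ℂ))) : Matrix (Fin N) (Fin N) ℂ)) = 0 :=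
    Finset.sum_eq_zero fun i _ => by rw [coe_coreFamily, if_pos i.2, MatrixLog.mlog_one]
  rw [← hsplit, hcentral, zero_add, Finset.smul_sum]
  refine Finset.sum_congr rfl fun i _ => ?_
  rw [coe_coreFamily, if_neg i.2]
  congr 1
  push_cast
  rfl

/-- **The guard transfers**: each non-central `Vᵢ w*` lies in the typed guard `‖· − 1‖ < δ_N = deltaSU`. [folklore] -/
theorem guard_of_core (c : PBond P (j + 1)) (V : Idx P → (Matrix.specialUnitaryGroup (Fin N) ℂ)) (w : (Matrix.specialUnitaryGroup (Fin N) ℂ))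
    (hg : ∀ i : Idx P, dist1 (if IsCentral c i then (1 : (Matrix.specialUnitaryGroup (Fin N) ℂ)) else V i * w⁻¹) < (expMeanLogSU : LoopAverage (Matrix.specialUnitaryGroup (Fin N) ℂ)).δ)
    (i : {i : Idx P // ¬ IsCentral c i}) :
    ‖((V i : (Matrix.specialUnitaryGroup (Fin N) ℂ)) : Matrix (Fin N) (Fin N) ℂ) * star ((w : (Matrix.specialUnitaryGroup (Fin N) ℂ)) : Matrix (Fin N) (Fin N) ℂ) - 1‖ < deltaSU (Fin N) := by
  have h := hg i
  rw [if_neg i.2] at h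
  have e : (((V i * w⁻¹ : (Matrix.specialUnitaryGroup (Fin N) ℂ))) : Matrix (Fin N) (Fin N) ℂ) = (V i : Matrix (Fin N) (Fin N) ℂ) * star (w : Matrix (Fin N) (Fin N) ℂ) := by
    rw [Submonoid.coe_mul, ← Matrix.star_eq_inv]; rfl
  rw [← e]
  exact h

/-- The equal weights `|Idx|⁻¹` over the non-central indices: non-negative, total `#non-central ∕ |Idx| ≤ 1`,
deficit `1 − Σ = #central ∕ |Idx|`. [folklore] -/
theorem weights_core (c : PBond P (j + 1)) :
    (∀ _i : {i : Idx P // ¬ IsCentral c i}, (0 : ℝ) ≤ ((Fintype.card (Idx P) : ℝ))⁻¹) ∧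
      ∑ _i : {i : Idx P // ¬ IsCentral c i}, ((Fintype.card (Idx P) : ℝ))⁻¹
        = (Fintype.card {i : Idx P // ¬ IsCentral c i} : ℝ) * ((Fintype.card (Idx P) : ℝ))⁻¹ ∧
      ∑ _i : {i : Idx P // ¬ IsCentral c i}, ((Fintype.card (Idx P) : ℝ))⁻¹ ≤ 1 := by
  have hcard : (0 : ℝ) < Fintype.card (Idx P) := Nat.cast_pos.mpr Fintype.card_pos
  have hsum : ∑ _i : {i : Idx P // ¬ IsCentral c i}, ((Fintype.card (Idx P) : ℝ))⁻¹
      = (Fintype.card {i : Idx P // ¬ IsCentral c i} : ℝ) * ((Fintype.card (Idx P) : ℝ))⁻¹ := by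
    rw [Finset.sum_const, Finset.card_univ, nsmul_eq_mul]
  refine ⟨fun _ => inv_nonneg.2 hcard.le, hsum, ?_⟩
  rw [hsum, ← div_eq_mul_inv, div_le_one hcard]
  exact_mod_cast Fintype.card_subtype_le _

/-! ## §3 THE JACOBIAN PINCH AT THE CORE MAP OF (H_K-core) -/

/-- ★★★ **THE JACOBIAN PINCH AT THE CORE MAP.**  For the printed `SU(N)` average, a coarse bond `c`, ANY finite family `V : Idx → SU(N)` and any
`w ∈ SU(N)` at which the core family meets the guard, every `ℝ`-linear endomorphism `T` of `𝔰𝔲(N)` agreeing with the left-trivialised tangent map of the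
core map `w ↦ Kmat (V|_{non-central}) (|Idx|⁻¹) w` (= the core map of (H_K-core) by `core_eq_kmat`) satisfies
  `(#central ∕ |Idx|)^{N² − 1} ≤ |det T| ≤ 1`     (stated with `1 − #non-central·|Idx|⁻¹`)
— parts 1∕2∕3c of this lineage at the dictionary's letters. [cite: Balaban1987RG1, (0.4) p.253 (bookkeeping over the printed operation)] -/
theorem core_tangent_pinch (c : PBond P (j + 1)) (V : Idx P → (Matrix.specialUnitaryGroup (Fin N) ℂ)) (w : (Matrix.specialUnitaryGroup (Fin N) ℂ))
    (hg : ∀ i : Idx P, dist1 (if IsCentral c i then (1 : (Matrix.specialUnitaryGroup (Fin N) ℂ)) else V i * w⁻¹) < (expMeanLogSU : LoopAverage (Matrix.specialUnitaryGroup (Fin N) ℂ)).δ)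
    (T : lieSU (Fin N) →ₗ[ℝ] lieSU (Fin N))
    (hT : ∀ X : lieSU (Fin N), ((T X : lieSU (Fin N)) : Matrix (Fin N) (Fin N) ℂ)
      = star (Kmat (fun i : {i : Idx P // ¬ IsCentral c i} => ((V i : (Matrix.specialUnitaryGroup (Fin N) ℂ)) : Matrix (Fin N) (Fin N) ℂ))
          (fun _ => ((Fintype.card (Idx P) : ℝ))⁻¹) (w : Matrix (Fin N) (Fin N) ℂ))
        * emlD (fun i : {i : Idx P // ¬ IsCentral c i} => ((V i : (Matrix.specialUnitaryGroup (Fin N) ℂ)) : Matrix (Fin N) (Fin N) ℂ))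
          (fun _ => ((Fintype.card (Idx P) : ℝ))⁻¹) (w : Matrix (Fin N) (Fin N) ℂ) ((w : Matrix (Fin N) (Fin N) ℂ) * (X : Matrix (Fin N) (Fin N) ℂ))) :
    (1 - (Fintype.card {i : Idx P // ¬ IsCentral c i} : ℝ) * ((Fintype.card (Idx P) : ℝ))⁻¹) ^ (N ^ 2 - 1) ≤ |LinearMap.det T| ∧
      |LinearMap.det T| ≤ 1 := by
  obtain ⟨hc0, hsum, hc1⟩ := weights_core c
  have h := abs_det_leftTangentSU_pinch_specialUnitary (ι := {i : Idx P // ¬ IsCentral c i})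
    (fun i => V i) w (guard_of_core c V w hg) hc0 hc1 T hT
  rwa [hsum, Fintype.card_fin] at h

end Summit.QuantumFields.YangMills.BalabanUVNodes.N08HaarCompatibilityGuardCoreKmatDictionary

end
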